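import Summits.BirchSwinnertonDyer.Rank1Residual.Additive.X3BranchCertificateRoadCardGe
import Summits.BirchSwinnertonDyer.Rank1Residual.Additive.X3BranchDegenerateEndStateOfFact
import HarnessLib

/-!
# X3, the DEGENERATE rows at `p = 3` (`W[3]^{ss} = {1, ω}`), rank `0`: the END STATES with the
# residual-count EVALUATION `hn` weakened to the LOWER BOUND `hnge : p^{n+Σδ+1} ≤ #H¹(ℚ_Σ/ℚ_∞, Φ₀)·#U`
# (cell `bsd-eis`, seat `bsd-eis-x3` gen 6; sequel of `X3BranchCertificateRoadCardGe.lean` and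
# `X3BranchDegenerateEndState[OfFact].lean`; route K1 `AdditiveBranchIMC`, crux
# `GordTwoRankZeroOffCaseOne` — supports only)

HONEST FRAMING (cell `bsd-eis`, `run/shared/lean/pub/bsd-eis/README.md` §4): the programme's target of
record is the full Birch–Swinnerton-Dyer formula for every `E/ℚ` of analytic rank `≤ 1`; this file
concerns the DEGENERATE X3♯(G-ord, `e = 2`) rows at `p = 3` (the `−3`-twists of ANOMALOUS good-ordinary
curves with reducible `3`-torsion; 1 381 rank-`0` classes of referee A's residue at state
16a6b5d318458b9f, each open exactly at the cell `(3, X3)`). THEOREMS ONLY (no `def`, no named fact, no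
`sorry`); nothing is booked; no label, tier or count of record moves. The end states of
`X3BranchDegenerateEndState[OfFact].lean` are re-cut through `X3BranchCertificateRoadCardGe.lean`:
the count `p^{λ(g)+Σδ+1} = #H¹·#U` (`X3Branch.algebraicCountW_degenerate_of_facts`, from the PUBLISHED
records `h23`, `hRQ`, `hGrK`, `hLiftE` + `hA`) and a LOWER BOUND `hnge` give `n ≤ λ(g)`
(`X3Branch.lamGeW_of_countSucc_of_cardGeFin`, §0: the bound is asked only for FINITE residual groups — the count makes them finite), which is all the certificate road consumes. DISPLAYED per
pair: `hcert` (one unit coefficient of `ϖ·B` at index `n` on every twist model) and `hnge` (to be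
supplied by EXHIBITED classes: order-`3` sub-characters of the mod-`ℓ` cyclotomic characters,
`ℓ ∈ Σ₀`, `ℓ ≡ 1 (mod 3)`, and Kummer classes of rational `Σ₀`-units that are cubes in `ℚ₃`).

* §0 `X3Branch.lamGeW_of_countSucc_of_cardGeFin` (count `+1` + finiteness-conditional lower bound),
* `ClassX3Gord.missingLowerBoundAt_rankZero_degenerate_of_facts_of_cardGe` (every odd `p`),
* `ClassX3Gord.bsdp_three_rankZero_degenerate_of_facts_of_cardGe` (`p = 3`, `hA` displayed),
* `ClassX3Gord.bsdp_three_rankZero_degenerate_of_facts_of_torsionFact_of_cardGe` (`hA` discharged by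
  the PUBLISHED record `Greenberg1999.finite_torsion_cyclotomicZpExtension`).

References: [Delbourgo1998] Prop. 4; [Wuthrich2014] Thm. 16; [GreenbergVatsal2000] §2 pp. 26–30,
Remark (2.7), Prop. (2.8), Remark (2.9); [GreenbergLNM1716] §1, §3 p. 86, Lemma 3.4, Props. 2.2/2.4;
[MazurTateTeitelbaum1986Invent] §I.13–I.14; [Miller2011LMS] Def. 1.1; [Ribet1981KatzLangAppendix];
cell files `run/shared/lean/pub/bsd-eis/x3-MEMO-{2,3}.md`.
-/

set_option autoImplicit false

noncomputable section

open scoped Classical MatrixGroups ModularForm AddSubgroup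

namespace Summit.BirchSwinnertonDyer.Rank1Residual.Additive

open CongruenceSubgroup WeierstrassCurve NumberField IsDedekindDomain Field
  Literature.NumberTheory.EllipticCurves
  Literature.NumberTheory.EllipticCurves.ModularForms
  Literature.NumberTheory.EllipticCurves.GreenbergSelmer
  Literature.NumberTheory.EllipticCurves.GreenbergVatsal2000
  Literature.NumberTheory.EllipticCurves.Rank1Residual
  Literature.NumberTheory.EllipticCurves.Rank1Residual.Typed
  Literature.NumberTheory.GaloisRepresentations
  Summit.BirchSwinnertonDyer.Rank1Residual.X1.MuLambda
  Summit.BirchSwinnertonDyer.Rank1Residual.AdditivePotMult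
  Summit.BirchSwinnertonDyer.Rank1Residual.Additive.X3Branch

/-! ### §0 Count + finiteness-conditional LOWER BOUND ⟹ `n ≤ λ(g)` -/

section Evaluation

variable {W : WeierstrassCurve ℚ} {p : ℕ} [hp : Fact p.Prime]

/-- **Count (`+1` form) + LOWER BOUND under finiteness ⟹ `n ≤ λ(g)`.** As
`X3Branch.lamGeW_of_countSucc_of_cardGe`, with the lower bound `hnge` asked only for FINITE
residual groups — the count `p^{λ(g)+Σδ+1} = #H¹·#U` (`hcount`) makes both `Nat.card`s non-zero,
hence both groups finite (`Nat.finite_of_card_ne_zero`); this is the shape in which EXHIBITED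
classes deliver the bound (`Nat.card_le_card_of_injective` needs a finite target).
[cite: GreenbergVatsal2000, §2 Cor. (2.3), p. 30] -/
theorem X3Branch.lamGeW_of_countSucc_of_cardGeFin (S₀ : Finset (HeightOneSpectrum (𝓞 ℚ)))
    {Φ₀ : AddSubgroup (W.geomTorsion (p : ℤ))} (hΦ : IsRationalLine W p Φ₀) {n : ℕ}
    (hcount : ∀ {κ : ZpExtension ℚ p} {γ : Field.absoluteGaloisGroup ℚ} (D : W.SelmerDualData κ γ)
      (g : IwasawaAlgebra p), κ.IsCyclotomic → κ.IsTopGenerator γ → D.IsTorsion →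
      D.charIdeal = Ideal.span {g} → HasUnitContent g →
        p ^ (lam g + ∑ v ∈ S₀, delta W p v + 1) =
          Nat.card (residualLineH1 W p κ S₀ Φ₀ hΦ) * Nat.card (residualQuotSelmer W p κ S₀ Φ₀ hΦ))
    (hnge : ∀ (κ : ZpExtension ℚ p), κ.IsCyclotomic →
      Finite (residualLineH1 W p κ S₀ Φ₀ hΦ) → Finite (residualQuotSelmer W p κ S₀ Φ₀ hΦ) →
      p ^ (n + ∑ v ∈ S₀, delta W p v + 1) ≤
        Nat.card (residualLineH1 W p κ S₀ Φ₀ hΦ) * Nat.card (residualQuotSelmer W p κ S₀ Φ₀ hΦ))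
    {κ : ZpExtension ℚ p} {γ : Field.absoluteGaloisGroup ℚ} (D : W.SelmerDualData κ γ)
    (g : IwasawaAlgebra p) (hκ : κ.IsCyclotomic) (hγ : κ.IsTopGenerator γ) (hDt : D.IsTorsion)
    (hchar : D.charIdeal = Ideal.span {g}) (hμg : HasUnitContent g) : n ≤ lam g := by
  have hc := hcount D g hκ hγ hDt hchar hμg
  have hne : Nat.card (residualLineH1 W p κ S₀ Φ₀ hΦ) * Nat.card (residualQuotSelmer W p κ S₀ Φ₀ hΦ)
      ≠ 0 := hc ▸ pow_ne_zero _ hp.out.ne_zero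
  have h1 : Finite (residualLineH1 W p κ S₀ Φ₀ hΦ) :=
    Nat.finite_of_card_ne_zero (left_ne_zero_of_mul hne)
  have h2 : Finite (residualQuotSelmer W p κ S₀ Φ₀ hΦ) :=
    Nat.finite_of_card_ne_zero (right_ne_zero_of_mul hne)
  have hpow : p ^ (n + ∑ v ∈ S₀, delta W p v + 1) ≤ p ^ (lam g + ∑ v ∈ S₀, delta W p v + 1) :=
    (hnge κ hκ h1 h2).trans_eq hc.symm
  have := (Nat.pow_le_pow_iff_right hp.out.two_le).mp hpow
  omega

end Evaluation

/-! ### §3 The DEGENERATE rows with the LOWER BOUND `hnge` instead of the evaluation `hn` -/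

section Degenerate

variable {p : ℕ} [hp : Fact p.Prime] {W : WeierstrassCurve ℚ} [W.IsElliptic] [W.IsGloballyMinimal]

/-- **X3♯(G-ord) ∩ `I₀*` ∧ `r_an = 0`, DEGENERATE rows, every odd `p`: `Typed.MissingLowerBoundAt W p`
from the PUBLISHED records + the line datum + `hA` + `hcert` + the LOWER BOUND `hnge`** (as
`ClassX3Gord.missingLowerBoundAt_rankZero_degenerate_of_facts` with `hn` ↦ `hnge`).
[cite: Delbourgo1998, Prop. 4 (p. 144)] [cite: GreenbergLNM1716, §3 Lemma 3.4 (p. 89), Props. 2.2, 2.4]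
[cite: Wuthrich2014, Thm. 16 (p. 397)] [cite: GreenbergVatsal2000, §2 pp. 26–30, Remark (2.7), Prop. (2.8), Remark (2.9)]
[cite: MazurTateTeitelbaum1986Invent, §I.13–I.14] [cite: Miller2011LMS, Def. 1.1] -/
theorem ClassX3Gord.missingLowerBoundAt_rankZero_degenerate_of_facts_of_cardGe
    (hDelG : Delbourgo1998.prop4_rankZero_constantCoeff_eq_unit_mul_of_potGoodOrd)
    (hGZK : rank_eq_analyticRank_of_analyticRank_le_one) (hmod : hasEntireLFunction_rat)
    (hmodD : nonempty_modularParametrizationData)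
    (hW16 : Wuthrich2014.thm16_halfEigenCharIdeal_dvd_cyclotomicPrime)
    (h23 : datumSelmer_nonPrimitive_invariants)
    (hRQ : datumSelmer_divisible_of_finite_torsionBy_of_gr_inertiaInvariants_eq_zero)
    (hGrK : Greenberg1999.imKummer_ge_strictCondition_goodOrdinary)
    (hLiftE : residualEpsilon_surjOn_of_lineEven)
    (hX : ClassX3Gord W p) (hp2 : p ≠ 2) (he : semistabilityIndex W p = 2) (hr : W.analyticRank = 0)
    (S₀ : Finset (HeightOneSpectrum (𝓞 ℚ))) (hne : S₀.Nonempty)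
    (hS₀ : ∀ v ∈ S₀, ((p : ℕ) : 𝓞 ℚ) ∉ v.asIdeal)
    (hS : ∀ v : HeightOneSpectrum (𝓞 ℚ), v ∉ S₀ → ((p : ℕ) : 𝓞 ℚ) ∉ v.asIdeal →
      W.HasGoodReductionAt v)
    (Φ₀ : AddSubgroup (W.geomTorsion (p : ℤ))) (hΦ : IsRationalLine W p Φ₀)
    (htriv : ∀ (σ : absoluteGaloisGroup ℚ) (P : geomTorsion W (p : ℤ)), P ∈ Φ₀ → σ • P = P)
    (hA : ∀ κ : ZpExtension ℚ p, κ.IsCyclotomic →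
      Finite (FixedPoints.addSubgroup κ.kerSubgroup (W.geomPrimaryTorsion p)))
    {n : ℕ}
    (hcert : ∀ (V : WeierstrassCurve ℚ) [V.IsElliptic] [V.IsGloballyMinimal] (C : VariableChange ℚ),
      C • V.quadraticTwist ((-1) ^ (p / 2) * p : ℚ) = W → X3BranchUnitCoeffCertAt V p n)
    (hnge : ∀ (κ : ZpExtension ℚ p), κ.IsCyclotomic →
      Finite (residualLineH1 W p κ S₀ Φ₀ hΦ) → Finite (residualQuotSelmer W p κ S₀ Φ₀ hΦ) →
      p ^ (n + ∑ v ∈ S₀, delta W p v + 1) ≤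
        Nat.card (residualLineH1 W p κ S₀ Φ₀ hΦ) * Nat.card (residualQuotSelmer W p κ S₀ Φ₀ hΦ)) :
    MissingLowerBoundAt W p := by
  obtain ⟨V, _, _, C, hV, hC⟩ := ClassX3Gord.exists_goodOrd_pStar_twist_model W p hp2 hX he
  exact ClassX3Gord.missingLowerBoundAt_rankZero_of_unitCoeffCert_of_lamGeW hDelG hGZK hmod hmodD hW16
    hX hp2 he hr hcert
    (fun D g hκ hγ hDt hchar hμg ↦ X3Branch.lamGeW_of_countSucc_of_cardGeFin S₀ hΦ
      (fun D' g' hκ' hγ' hDt' hg' hμ' ↦ X3Branch.algebraicCountW_degenerate_of_facts h23 hRQ hGrK hLiftE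
        hp2 V hV hC S₀ hne hS₀ hS Φ₀ hΦ htriv (hA _ hκ') D' g' hκ' hγ' hDt' hg' hμ')
      hnge D g hκ hγ hDt hchar hμg)

/-- **X3♯(G-ord) ∩ `I₀*` at `p = 3`, `r_an = 0`, DEGENERATE rows: Miller's `BSD(E,3)`** from the
PUBLISHED records + the line datum + `hA` + `hcert` + the LOWER BOUND `hnge` (as
`ClassX3Gord.bsdp_three_rankZero_degenerate_of_facts` with `hn` ↦ `hnge`). NOT a class theorem.
[cite: Delbourgo1998, Prop. 4 (p. 144)] [cite: Wuthrich2014, Thm. 16 (p. 397)]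
[cite: GreenbergVatsal2000, §2 pp. 26–30, Remark (2.7), Remark (2.9)] [cite: Miller2011LMS, §1 and Def. 1.1] -/
theorem ClassX3Gord.bsdp_three_rankZero_degenerate_of_facts_of_cardGe [Fact (Nat.Prime 3)]
    {W : WeierstrassCurve ℚ} [W.IsElliptic] [W.IsGloballyMinimal]
    (hDelG : Delbourgo1998.prop4_rankZero_constantCoeff_eq_unit_mul_of_potGoodOrd)
    (hDel98 : Delbourgo1998.prop4_rankZero_pow_dvd_constantCoeff)
    (hGZK : rank_eq_analyticRank_of_analyticRank_le_one) (hmod : hasEntireLFunction_rat)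
    (hmodD : nonempty_modularParametrizationData)
    (hW16 : Wuthrich2014.thm16_halfEigenCharIdeal_dvd_cyclotomicPrime)
    (h23 : datumSelmer_nonPrimitive_invariants)
    (hRQ : datumSelmer_divisible_of_finite_torsionBy_of_gr_inertiaInvariants_eq_zero)
    (hGrK : Greenberg1999.imKummer_ge_strictCondition_goodOrdinary)
    (hLiftE : residualEpsilon_surjOn_of_lineEven)
    (hX : ClassX3Gord W 3) (hr : W.analyticRank = 0)
    (S₀ : Finset (HeightOneSpectrum (𝓞 ℚ))) (hne : S₀.Nonempty)
    (hS₀ : ∀ v ∈ S₀, (((3 : ℕ) : ℕ) : 𝓞 ℚ) ∉ v.asIdeal)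
    (hS : ∀ v : HeightOneSpectrum (𝓞 ℚ), v ∉ S₀ → (((3 : ℕ) : ℕ) : 𝓞 ℚ) ∉ v.asIdeal →
      W.HasGoodReductionAt v)
    (Φ₀ : AddSubgroup (W.geomTorsion ((3 : ℕ) : ℤ))) (hΦ : IsRationalLine W 3 Φ₀)
    (htriv : ∀ (σ : absoluteGaloisGroup ℚ) (P : geomTorsion W ((3 : ℕ) : ℤ)), P ∈ Φ₀ → σ • P = P)
    (hA : ∀ κ : ZpExtension ℚ 3, κ.IsCyclotomic →
      Finite (FixedPoints.addSubgroup κ.kerSubgroup (W.geomPrimaryTorsion 3)))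
    {n : ℕ}
    (hcert : ∀ (V : WeierstrassCurve ℚ) [V.IsElliptic] [V.IsGloballyMinimal] (C : VariableChange ℚ),
      C • V.quadraticTwist ((-1) ^ ((3 : ℕ) / 2) * (3 : ℕ) : ℚ) = W → X3BranchUnitCoeffCertAt V 3 n)
    (hnge : ∀ (κ : ZpExtension ℚ 3), κ.IsCyclotomic →
      Finite (residualLineH1 W 3 κ S₀ Φ₀ hΦ) → Finite (residualQuotSelmer W 3 κ S₀ Φ₀ hΦ) →
      3 ^ (n + ∑ v ∈ S₀, delta W 3 v + 1) ≤
        Nat.card (residualLineH1 W 3 κ S₀ Φ₀ hΦ) * Nat.card (residualQuotSelmer W 3 κ S₀ Φ₀ hΦ)) :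
    BSDp W 3 := by
  have he : semistabilityIndex W 3 = 2 :=
    semistabilityIndex_eq_two_of_typeG_three W hX.typeGOrd.typeG hX.addv
  obtain ⟨V, _, _, C, hV, hC⟩ := ClassX3Gord.exists_goodOrd_pStar_twist_model W 3 (by norm_num) hX he
  exact ClassX3Gord.bsdp_three_rankZero_of_unitCoeffCert_of_lamGeW hDelG hDel98 hGZK hmod hmodD hW16 hX
    hr hcert
    (fun D g hκ hγ hDt hchar hμg ↦ X3Branch.lamGeW_of_countSucc_of_cardGeFin S₀ hΦ
      (fun D' g' hκ' hγ' hDt' hg' hμ' ↦ X3Branch.algebraicCountW_degenerate_of_facts h23 hRQ hGrK hLiftE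
        (by norm_num) V hV hC S₀ hne hS₀ hS Φ₀ hΦ htriv (hA _ hκ') D' g' hκ' hγ' hDt' hg' hμ')
      hnge D g hκ hγ hDt hchar hμg)

/-- **X3♯(G-ord) ∩ `I₀*` at `p = 3`, `r_an = 0`, DEGENERATE rows: Miller's `BSD(E,3)` from PUBLISHED
records ONLY + the line datum + the two per-pair inputs `hcert` and the LOWER BOUND `hnge`** (`hA`
discharged by the PUBLISHED record `hTors` = `Greenberg1999.finite_torsion_cyclotomicZpExtension`,
Greenberg LNM 1716 §1 / Imai / Ribet). The per-pair display shape of the seat's degenerate road.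
[cite: GreenbergLNM1716, §1 and §3 p. 86] [cite: Delbourgo1998, Prop. 4 (p. 144)]
[cite: Wuthrich2014, Thm. 16 (p. 397)] [cite: Miller2011LMS, §1 and Def. 1.1] -/
theorem ClassX3Gord.bsdp_three_rankZero_degenerate_of_facts_of_torsionFact_of_cardGe
    [Fact (Nat.Prime 3)] {W : WeierstrassCurve ℚ} [W.IsElliptic] [W.IsGloballyMinimal]
    (hTors : Greenberg1999.finite_torsion_cyclotomicZpExtension)
    (hDelG : Delbourgo1998.prop4_rankZero_constantCoeff_eq_unit_mul_of_potGoodOrd)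
    (hDel98 : Delbourgo1998.prop4_rankZero_pow_dvd_constantCoeff)
    (hGZK : rank_eq_analyticRank_of_analyticRank_le_one) (hmod : hasEntireLFunction_rat)
    (hmodD : nonempty_modularParametrizationData)
    (hW16 : Wuthrich2014.thm16_halfEigenCharIdeal_dvd_cyclotomicPrime)
    (h23 : datumSelmer_nonPrimitive_invariants)
    (hRQ : datumSelmer_divisible_of_finite_torsionBy_of_gr_inertiaInvariants_eq_zero)
    (hGrK : Greenberg1999.imKummer_ge_strictCondition_goodOrdinary)
    (hLiftE : residualEpsilon_surjOn_of_lineEven)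
    (hX : ClassX3Gord W 3) (hr : W.analyticRank = 0)
    (S₀ : Finset (HeightOneSpectrum (𝓞 ℚ))) (hne : S₀.Nonempty)
    (hS₀ : ∀ v ∈ S₀, (((3 : ℕ) : ℕ) : 𝓞 ℚ) ∉ v.asIdeal)
    (hS : ∀ v : HeightOneSpectrum (𝓞 ℚ), v ∉ S₀ → (((3 : ℕ) : ℕ) : 𝓞 ℚ) ∉ v.asIdeal →
      W.HasGoodReductionAt v)
    (Φ₀ : AddSubgroup (W.geomTorsion ((3 : ℕ) : ℤ))) (hΦ : IsRationalLine W 3 Φ₀)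
    (htriv : ∀ (σ : absoluteGaloisGroup ℚ) (P : geomTorsion W ((3 : ℕ) : ℤ)), P ∈ Φ₀ → σ • P = P)
    {n : ℕ}
    (hcert : ∀ (V : WeierstrassCurve ℚ) [V.IsElliptic] [V.IsGloballyMinimal] (C : VariableChange ℚ),
      C • V.quadraticTwist ((-1) ^ ((3 : ℕ) / 2) * (3 : ℕ) : ℚ) = W → X3BranchUnitCoeffCertAt V 3 n)
    (hnge : ∀ (κ : ZpExtension ℚ 3), κ.IsCyclotomic →
      Finite (residualLineH1 W 3 κ S₀ Φ₀ hΦ) → Finite (residualQuotSelmer W 3 κ S₀ Φ₀ hΦ) →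
      3 ^ (n + ∑ v ∈ S₀, delta W 3 v + 1) ≤
        Nat.card (residualLineH1 W 3 κ S₀ Φ₀ hΦ) * Nat.card (residualQuotSelmer W 3 κ S₀ Φ₀ hΦ)) :
    BSDp W 3 :=
  ClassX3Gord.bsdp_three_rankZero_degenerate_of_facts_of_cardGe hDelG hDel98 hGZK hmod hmodD hW16 h23
    hRQ hGrK hLiftE hX hr S₀ hne hS₀ hS Φ₀ hΦ htriv (fun κ hκ ↦ hTors W 3 κ hκ) hcert hnge

end Degenerate

end Summit.BirchSwinnertonDyer.Rank1Residual.Additive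

end
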